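import Summits.BirchSwinnertonDyer.BirchSwinnertonDyer.Theorems.PrintX8VSInputHondaSystemLocalTraces
import HarnessLib

/-!
# The `Δ`-descended Honda points on the `ℤ_p`-layers at `ℚ_p`: levels and the three trace relations of
# `Sprung2012.IsHondaSystem` (route `PrintX8VS` / `PrintX8`, support item `InputHondaSystem` = stmt-BirchSwinnertonDyer-20413, named
# fact `Sprung2012.thm22_exists_isHondaSystem`; file 13 of the local series)

HONEST FRAMING (desk `pub/bsd-wall/bsd-inputs`, seat `bsd-inputs-honda-p1`, D-0154 (2) INPUTS): THEOREMS ONLY — no definition, no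
named fact, no instance, no `sorry`; bookkeeping on `localPoints W ℚ_[p]`; closes nothing by itself; BSD is not proved by any of this.

## Setting (file `…LocalTraces`)

`p` odd, `κ` cyclotomic, `ι`, `W/ℚ`, the tower `U n ≤ L_n = κ.layerSubgroup n` with local subgroups `Stab(ζ_{n+1})`, `𝒟_n = Tr_{k_n/ℚ_{p,n}}`,
`Tr_{n+1/n}`. INPUT (abstract, supplied by files `…SprungTowerPoints/Relations` through `toLoc`): points `y m ∈ E(k_{m−1})` (`y 0 = O`)
and `Q ∈ E(ℚ_p)` with `Tr_{k_m/k_{m−1}} y_{m+1} = a•y_m − y_{m−1} − Q` (`m ≥ 1`) and `Tr_{k_0/ℚ_p} y_1 = −Q`, and an integer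
`N₁ = p + 1 − a` (`= #Ẽ(𝔽_p)`). OUTPUT: the RESCALED `Δ`-descent
`c_n := N₁•𝒟_n(y_{n+1}) + (p−1)•Q ∈ E(ℚ_{p,n})`, `c_{−1} := Q`, satisfies VERBATIM the relations of `IsHondaSystem`:
`c_0 = (a−2)•c_{−1}`, `Tr_{1/0} c_1 = a•c_0 − (p−1)•c_{−1}`, `Tr_{n+1/n} c_{n+1} = a•c_n − c_{n−1}` (`n ≥ 1`)
(the rescaling by the `p`-adic unit `N₁` replaces Sprung's division of `Q` by `p + 1 − a`).

References: [Sprung2012] F. Sprung, J. Number Theory 132 (2012), §2 p. 1486, Thm. 2.2 (p. 1487); [Kobayashi2003] S. Kobayashi,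
Invent. Math. 152 (2003), Lemma 8.9.
-/

set_option autoImplicit false
-- the Theorems namespace of this sub repeats the summit name by design (D-0017 nested layout)
set_option linter.dupNamespace false

noncomputable section

open scoped Classical

namespace Summit.BirchSwinnertonDyer.BirchSwinnertonDyer.Theorems

namespace SprungHonda

open Literature.NumberTheory.EllipticCurves Literature.NumberTheory.GaloisRepresentations
  Literature.NumberTheory.EllipticCurves.ZpExtension Literature.NumberTheory.EllipticCurves.Kobayashi2003
  Summit.BirchSwinnertonDyer.Rank1Residual.Additive Summit.BirchSwinnertonDyer.Rank1Residual.Additive.PadicCyclotomicTower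

variable {p : ℕ} [hp : Fact p.Prime] (κ : ZpExtension ℚ p) (ι : AlgebraicClosure ℚ →ₐ[ℚ] AlgebraicClosure ℚ_[p])
  (W : WeierstrassCurve ℚ) (U : ℕ → Subgroup (Field.absoluteGaloisGroup ℚ)) [hUf : ∀ n, (U n).FiniteIndex]

/-- **Levels**: `c_n = N₁•𝒟_n(y_{n+1}) + (p−1)•Q ∈ E(ℚ_{p,n})`. [cite: Sprung2012, Thm. 2.2 (p. 1487)] -/
theorem descent_mem_layer {N₁ : ℤ} {y : ℕ → localPoints W ℚ_[p]} {Q : localPoints W ℚ_[p]}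
    (hyU : ∀ m, y (m + 1) ∈ localFixedPointsOfEmb ι W (U m)) (hQ : Q ∈ localLayerPointsOfEmb κ ι W 0) (n : ℕ) :
    N₁ • localPairTraceOfEmb ι W (κ.layerSubgroup n) (U n) (y (n + 1)) + ((p : ℤ) - 1) • Q ∈ localLayerPointsOfEmb κ ι W n := by
  exact add_mem (AddSubgroup.zsmul_mem _ (localPairTraceOfEmb_mem_layer κ ι W U n (hyU n)) _)
    (AddSubgroup.zsmul_mem _ (localLayerPointsOfEmb_mono κ ι W (Nat.zero_le n) hQ) _)

/-- **The three trace relations of `IsHondaSystem` for the rescaled `Δ`-descent.** With `𝒟_n = Tr_{k_n/ℚ_{p,n}}`,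
`c_n = N₁•𝒟_n(y_{n+1}) + (p−1)•Q`, `N₁ = p + 1 − a`: `c_0 = (a−2)•Q`, `Tr_{1/0} c_1 = a•c_0 − (p−1)•Q`, `Tr_{n+1/n} c_{n+1} = a•c_n − c_{n−1}`
(`n ≥ 1`) — from `Tr_{k_m/k_{m−1}} y_{m+1} = a y_m − y_{m−1} − Q`, `Tr_{k_0/ℚ_p} y_1 = −Q`, transitivity `Tr_{n+1/n} ∘ 𝒟_{n+1} = 𝒟_n ∘ Tr_{k_{n+1}/k_n}`,
the `Δ`-bijection `𝒟_n y_n = 𝒟_{n−1} y_n`, and `𝒟_n = p − 1`, `Tr_{n+1/n} = p` on `E(ℚ_{p,n})`.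
[cite: Sprung2012, §2 p. 1486 and Thm. 2.2 (p. 1487)] [cite: Kobayashi2003, Lemma 8.9] -/
theorem descent_relations (hp2 : p ≠ 2) (hκ : κ.IsCyclotomic) (hUa : Antitone U) (hUL : ∀ n, U n ≤ κ.layerSubgroup n)
    (hU : ∀ n, localSubgroupOfEmb (U n) ι = stab p (n + 1)) {a N₁ : ℤ} (hN₁ : N₁ = p + 1 - a)
    {y : ℕ → localPoints W ℚ_[p]} {Q : localPoints W ℚ_[p]} (hy0 : y 0 = 0)
    (hyU : ∀ m, y (m + 1) ∈ localFixedPointsOfEmb ι W (U m)) (hQ : Q ∈ localLayerPointsOfEmb κ ι W 0)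
    (hrel0 : localPairTraceOfEmb ι W (κ.layerSubgroup 0) (U 0) (y 1) = -Q)
    (hrel : ∀ m : ℕ, 1 ≤ m → localPairTraceOfEmb ι W (U (m - 1)) (U m) (y (m + 1)) = a • y m - y (m - 1) - Q)
    (c : ℕ → localPoints W ℚ_[p])
    (hc : ∀ n, c n = N₁ • localPairTraceOfEmb ι W (κ.layerSubgroup n) (U n) (y (n + 1)) + ((p : ℤ) - 1) • Q) :
    c 0 = (a - 2) • Q ∧
    localTraceOfEmb κ ι W 0 1 (c 1) = a • c 0 - ((p : ℤ) - 1) • Q ∧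
    (∀ n : ℕ, 1 ≤ n → localTraceOfEmb κ ι W n (n + 1) (c (n + 1)) = a • c n - c (n - 1)) := by
  subst hN₁
  have hmono := localLayerPointsOfEmb_mono κ ι W
  have hQn : ∀ n, Q ∈ localLayerPointsOfEmb κ ι W n := fun n ↦ hmono (Nat.zero_le n) hQ
  -- `𝒟_n Q = (p−1)•Q`, `Tr_{n+1/n} Q = p•Q` (as `ℤ`-multiples)
  have hp1 : (((p - 1 : ℕ) : ℤ)) = (p : ℤ) - 1 := by have := hp.out.one_lt; omega
  have hDQ : ∀ n, localPairTraceOfEmb ι W (κ.layerSubgroup n) (U n) Q = ((p : ℤ) - 1) • Q := fun n ↦ by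
    rw [localPairTraceOfEmb_of_mem_layer κ ι W U hp2 hκ hU (hQn n), ← natCast_zsmul, hp1]
  have hTQ : ∀ n, localTraceOfEmb κ ι W n (n + 1) Q = (p : ℤ) • Q := fun n ↦ by
    rw [localTraceOfEmb_of_mem_layer κ ι W hp2 hκ (hQn n), natCast_zsmul]
  -- `Tr_{n+1/n}(𝒟_{n+1} y_{n+2}) = a•𝒟_n y_{n+1} − 𝒟_n y_n − (p−1)•Q`
  have hTD : ∀ n, localTraceOfEmb κ ι W n (n + 1) (localPairTraceOfEmb ι W (κ.layerSubgroup (n + 1)) (U (n + 1)) (y (n + 2))) =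
      a • localPairTraceOfEmb ι W (κ.layerSubgroup n) (U n) (y (n + 1)) -
        localPairTraceOfEmb ι W (κ.layerSubgroup n) (U n) (y n) - ((p : ℤ) - 1) • Q := by
    intro n
    rw [localTraceOfEmb_localPairTraceOfEmb κ ι W U hUa hUL (hyU (n + 1)),
      show localPairTraceOfEmb ι W (U n) (U (n + 1)) (y (n + 2)) = a • y (n + 1) - y n - Q by
        simpa using hrel (n + 1) (Nat.succ_pos n), map_sub, map_sub, map_zsmul, hDQ]
  -- `c_0 = (a−2)•Q`
  have hc0 : c 0 = (a - 2) • Q := by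
    rw [hc 0, hrel0, smul_neg, ← neg_smul, ← add_smul]
    congr 1
    ring
  refine ⟨hc0, ?_, ?_⟩
  · -- `Tr_{1/0} c_1 = a•c_0 − (p−1)•Q`
    rw [hc 1, map_add, map_zsmul, map_zsmul, hTD 0, hy0, map_zero, sub_zero, hrel0, hTQ 0, hc0]
    module
  · intro n hn
    obtain ⟨k, rfl⟩ := Nat.exists_eq_add_of_le' hn
    rw [hc (k + 1 + 1), map_add, map_zsmul, map_zsmul, show k + 1 + 2 = k + 1 + 1 + 1 from rfl, hTD (k + 1), hTQ (k + 1),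
      localPairTraceOfEmb_succ_eq κ ι W U hp2 hκ hU (hyU k), hc (k + 1), Nat.add_sub_cancel, hc k]
    module

end SprungHonda

end Summit.BirchSwinnertonDyer.BirchSwinnertonDyer.Theorems

end
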